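import Summits.Ventures.Crystal3D.Theorems.StickyWulffConstantTextureLiminfTexShadowSteepPlateLaunchCore
import HarnessLib

/-!
# TexShadow row (e) / EDGE-ON (ε₂): NOT STEEP ⇒ LAUNCHABLE — the launch-failure set of the two-sided wide-steered ledger IS `SteepPlateAt`
# (lane T, crux `TextureLiminfV5`, stmt-Ventures-23912, sub-crux EDGE-ON; cf-p1 DECISION (cxxxvii)(2)(b); memo HOME/wall-p1-g15/STEEP-PLATE-g15.md §2)

HONEST FRAMING. Venture `Summits/Ventures/Crystal3D` (cell `crystal3d-full`), route `route-Ventures-StickyWulffConstant`, helper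
`--supports` the law-v5 crux `TextureLiminfV5` (stmt-Ventures-23912).  PROOFS ONLY (elementary real geometry); NO certificate is asserted;
nothing about any wall law is proved; rung F-C1 not moved.

THE POINT.  `…TexShadowSteepPlateDefs` (p706442) typed the EDGE-ON corner `SteepPlateAt c L e` («every reference up-slot of the up-presentation
rises by `< steerSteepCos c = cos(45° + θ_c)` along `e`») and proved that a steep plate admits NO launch `(z, v)` of the steered ledgers
(`not_steerLaunchAt_of_steepPlateAt`).  This file proves the CONVERSE, so that the launch-failure set is `SteepPlateAt` EXACTLY:
* `capper_floor_model(₁/₂/₃)` — the ∇-CAPPER FLOOR in the model: for a reference up-slot `v` with `⟪v, ν⟫ ≥ t ≥ 1/4` (`ν` the unit model axis,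
  `ν₂ ≥ 0`), a steering `ζ = α v + β ν` (`α ≥ 0 < β`) and a reference up-slot `w` minimising `⟪basalMirror ·, ζ⟫` (so `−w` is a `ζ`-best capper
  of the basal twin), the capper rises by `−⟪basalMirror w, ν⟫ ≥ 1/4` (nine coordinate cases fed to `capperFloor_core` of part 1);
* **`exists_steerLaunchAt_of_not_steepPlateAt`** — `‖e‖ = 1`, `0 ≤ c ≤ 1`, `1/4 ≤ steerSteepCos c` (every chord `c ≤ 1/2`; the chords of record are
  `1/4` and `1/3`) and `¬ SteepPlateAt c L e` ⇒ `∃ z v, SteerLaunchAt c L σ e z v` for EVERY word `σ`, with the explicit steering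
  `z := upFrame L e ζ` of `exists_model_steering` (part 1) and the capper identified through `bestCapper_nabla_slot` / `bestCapper_spec` /
  `twinFrame_axis_apply`;
* **`exists_steerLaunchAt_iff_not_steepPlateAt`** — THE DICHOTOMY `(∃ z v, SteerLaunchAt c L σ e z v) ↔ ¬ SteepPlateAt c L e`, and its instances
  `…_third` / `…_third_neg` at the chord of record toward `e₃` / `−e₃`.
CONSEQUENCE (memo §3): what the (ε₂) ledger `BarlowTwoSidedCertifiedSteerWide` leaves uncertified is contained in
`SteepPairAt (1/3)` ∪ {both plates launch but a frame clause (i)/(ii)/(iii) or the flux-sum clause fails} — the mechanism-only EDGE-ON corner is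
the steep-plate set, in closed form.
WHAT THIS IS NOT: no coverage certificate; nothing about the sep-(iii) / read / flux-sum clauses; F-C1 not moved.
-/

noncomputable section

open scoped BigOperators InnerProductSpace ENNReal
open MeasureTheory Filter

namespace Summit.Ventures.Crystal3D.Cruxes.TextureLiminf.TexShadow

open Summit.Ventures.Crystal3D Summit.Ventures.Crystal3D.Theorems
open Literature.MathematicalPhysics.StatisticalMechanics (IsHaggSeq fccStacking barlowStacking basalMirror barlowPos_apply_zero
  barlowPos_apply_one barlowPos_apply_two basalMirror_apply_coord)

/-! ## The capper floor in the model -/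

/-- The table `⟪basalMirror upSlotᵢ, upSlotₖ⟫ = g_{ik} − 2/3` (`g_{kk} = 1/3`, `g_{ik} = −1/6`). -/
theorem inner_basalMirror_upSlot_upSlot :
    ⟪basalMirror upSlot₁, upSlot₁⟫_ℝ = -(1 / 3) ∧ ⟪basalMirror upSlot₁, upSlot₂⟫_ℝ = -(5 / 6) ∧ ⟪basalMirror upSlot₁, upSlot₃⟫_ℝ = -(5 / 6) ∧
    ⟪basalMirror upSlot₂, upSlot₁⟫_ℝ = -(5 / 6) ∧ ⟪basalMirror upSlot₂, upSlot₂⟫_ℝ = -(1 / 3) ∧ ⟪basalMirror upSlot₂, upSlot₃⟫_ℝ = -(5 / 6) ∧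
    ⟪basalMirror upSlot₃, upSlot₁⟫_ℝ = -(5 / 6) ∧ ⟪basalMirror upSlot₃, upSlot₂⟫_ℝ = -(5 / 6) ∧ ⟪basalMirror upSlot₃, upSlot₃⟫_ℝ = -(1 / 3) := by
  obtain ⟨a0, a1, a2⟩ := upSlot₁_coord; obtain ⟨b0, b1, b2⟩ := upSlot₂_coord; obtain ⟨c0, c1, c2⟩ := upSlot₃_coord
  have h3 : Real.sqrt 3 ^ 2 = 3 := Real.sq_sqrt (by norm_num)
  have hq2 : Real.sqrt (2 / 3) ^ 2 = 2 / 3 := Real.sq_sqrt (by norm_num)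
  refine ⟨?_, ?_, ?_, ?_, ?_, ?_, ?_, ?_, ?_⟩
  · rw [(inner_basalMirror_upSlot_fin3 upSlot₁).1, a0, a1, a2]; linear_combination (1 / 36 : ℝ) * h3 - hq2
  · rw [(inner_basalMirror_upSlot_fin3 upSlot₂).1, b0, b1, b2]; linear_combination (1 / 36 : ℝ) * h3 - hq2
  · rw [(inner_basalMirror_upSlot_fin3 upSlot₃).1, c0, c1, c2]; linear_combination (-1 / 18 : ℝ) * h3 - hq2
  · rw [(inner_basalMirror_upSlot_fin3 upSlot₁).2.1, a0, a1, a2]; linear_combination (1 / 36 : ℝ) * h3 - hq2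
  · rw [(inner_basalMirror_upSlot_fin3 upSlot₂).2.1, b0, b1, b2]; linear_combination (1 / 36 : ℝ) * h3 - hq2
  · rw [(inner_basalMirror_upSlot_fin3 upSlot₃).2.1, c0, c1, c2]; linear_combination (-1 / 18 : ℝ) * h3 - hq2
  · rw [(inner_basalMirror_upSlot_fin3 upSlot₁).2.2, a1, a2]; linear_combination (-1 / 18 : ℝ) * h3 - hq2
  · rw [(inner_basalMirror_upSlot_fin3 upSlot₂).2.2, b1, b2]; linear_combination (-1 / 18 : ℝ) * h3 - hq2
  · rw [(inner_basalMirror_upSlot_fin3 upSlot₃).2.2, c1, c2]; linear_combination (1 / 9 : ℝ) * h3 - hq2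

/-- Capper floor (model form), launch slot `upSlot₁`: see `capper_floor_model`. -/
theorem capper_floor_model₁ {ν ζ w : E3} {α β t : ℝ} (hνn : ‖ν‖ = 1) (hν2 : 0 ≤ ν 2) (ht : (1 / 4 : ℝ) ≤ t)
    (hr : t ≤ ⟪upSlot₁, ν⟫_ℝ) (hα : 0 ≤ α) (hβ : 0 < β) (hζ : ζ = α • upSlot₁ + β • ν)
    (hw : w ∈ fccSlots) (hw2 : w 2 = Real.sqrt (2 / 3))
    (hmin : ∀ u ∈ fccSlots, u 2 = Real.sqrt (2 / 3) → ⟪basalMirror w, ζ⟫_ℝ ≤ ⟪basalMirror u, ζ⟫_ℝ) :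
    (1 / 4 : ℝ) ≤ -⟪basalMirror w, ν⟫_ℝ := by
  obtain ⟨hu1, hu2, hu3⟩ := upSlots_mem_fccSlots
  have h3 : Real.sqrt 3 ^ 2 = 3 := Real.sq_sqrt (by norm_num)
  have hunit : ν 0 ^ 2 + ν 1 ^ 2 + ν 2 ^ 2 = 1 := by
    have h := real_inner_self_eq_norm_sq ν
    have h' : ∀ a b : E3, ⟪a, b⟫_ℝ = a 0 * b 0 + a 1 * b 1 + a 2 * b 2 := fun a b => by
      simp [PiLp.inner_apply, Fin.sum_univ_three, mul_comm]
    rw [hνn, one_pow, h'] at h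
    linear_combination h
  have hZ : ∀ u : E3, ⟪basalMirror u, ζ⟫_ℝ = α * ⟪basalMirror u, upSlot₁⟫_ℝ + β * ⟪basalMirror u, ν⟫_ℝ := by
    intro u; rw [hζ, inner_add_right, inner_smul_right, inner_smul_right]
  have hm1 := hmin upSlot₁ hu1 upSlot₁_coord.2.2
  have hm2 := hmin upSlot₂ hu2 upSlot₂_coord.2.2
  have hm3 := hmin upSlot₃ hu3 upSlot₃_coord.2.2
  obtain ⟨n1, n2, n3⟩ := inner_basalMirror_upSlot_fin3 ν
  obtain ⟨g11, g12, g13, g21, g22, g23, g31, g32, g33⟩ := inner_basalMirror_upSlot_upSlot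
  rw [(inner_upSlot_fin3 ν).1] at hr
  rcases eq_upSlot_of_apply_two hw hw2 with rfl | rfl | rfl
  · -- k = 1, j = 1
    simp only [hZ, g11, g21, g31, n1, n2, n3] at hm1 hm2 hm3
    rw [n1]
    have hsph : 2 * ((1 / 2 * ν 0 + Real.sqrt 3 / 6 * ν 1) ^ 2 + (-(1 / 2) * ν 0 + Real.sqrt 3 / 6 * ν 1) ^ 2 + (-(Real.sqrt 3 / 3) * ν 1) ^ 2) + ν 2 ^ 2 = 1 := by
      linear_combination hunit + (ν 1 ^ 2 / 3) * h3
    have hP : (1 / 2 * ν 0 + Real.sqrt 3 / 6 * ν 1) + (-(1 / 2) * ν 0 + Real.sqrt 3 / 6 * ν 1) + (-(Real.sqrt 3 / 3) * ν 1) = 0 := by ring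
    have hcore := (capperFloor_core (1 / 2 * ν 0 + Real.sqrt 3 / 6 * ν 1) (-(1 / 2) * ν 0 + Real.sqrt 3 / 6 * ν 1) (-(Real.sqrt 3 / 3) * ν 1) (ν 2) α β t hP hsph hν2 ht (by linarith only [hr]) hα hβ).1
      (by linarith only [hm2]) (by linarith only [hm3])
    linarith only [hcore]
  · -- k = 1, j = 2
    simp only [hZ, g21, g31, g11, n1, n2, n3] at hm1 hm2 hm3
    rw [n2]
    have hsph : 2 * ((1 / 2 * ν 0 + Real.sqrt 3 / 6 * ν 1) ^ 2 + (-(1 / 2) * ν 0 + Real.sqrt 3 / 6 * ν 1) ^ 2 + (-(Real.sqrt 3 / 3) * ν 1) ^ 2) + ν 2 ^ 2 = 1 := by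
      linear_combination hunit + (ν 1 ^ 2 / 3) * h3
    have hP : (1 / 2 * ν 0 + Real.sqrt 3 / 6 * ν 1) + (-(1 / 2) * ν 0 + Real.sqrt 3 / 6 * ν 1) + (-(Real.sqrt 3 / 3) * ν 1) = 0 := by ring
    have hcore := (capperFloor_core (1 / 2 * ν 0 + Real.sqrt 3 / 6 * ν 1) (-(1 / 2) * ν 0 + Real.sqrt 3 / 6 * ν 1) (-(Real.sqrt 3 / 3) * ν 1) (ν 2) α β t hP hsph hν2 ht (by linarith only [hr]) hα hβ).2
      (by linarith only [hm3])
    linarith only [hcore]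
  · -- k = 1, j = 3
    simp only [hZ, g31, g21, g11, n1, n2, n3] at hm1 hm2 hm3
    rw [n3]
    have hsph : 2 * ((1 / 2 * ν 0 + Real.sqrt 3 / 6 * ν 1) ^ 2 + (-(Real.sqrt 3 / 3) * ν 1) ^ 2 + (-(1 / 2) * ν 0 + Real.sqrt 3 / 6 * ν 1) ^ 2) + ν 2 ^ 2 = 1 := by
      linear_combination hunit + (ν 1 ^ 2 / 3) * h3
    have hP : (1 / 2 * ν 0 + Real.sqrt 3 / 6 * ν 1) + (-(Real.sqrt 3 / 3) * ν 1) + (-(1 / 2) * ν 0 + Real.sqrt 3 / 6 * ν 1) = 0 := by ring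
    have hcore := (capperFloor_core (1 / 2 * ν 0 + Real.sqrt 3 / 6 * ν 1) (-(Real.sqrt 3 / 3) * ν 1) (-(1 / 2) * ν 0 + Real.sqrt 3 / 6 * ν 1) (ν 2) α β t hP hsph hν2 ht (by linarith only [hr]) hα hβ).2
      (by linarith only [hm2])
    linarith only [hcore]

/-- Capper floor (model form), launch slot `upSlot₂`: see `capper_floor_model`. -/
theorem capper_floor_model₂ {ν ζ w : E3} {α β t : ℝ} (hνn : ‖ν‖ = 1) (hν2 : 0 ≤ ν 2) (ht : (1 / 4 : ℝ) ≤ t)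
    (hr : t ≤ ⟪upSlot₂, ν⟫_ℝ) (hα : 0 ≤ α) (hβ : 0 < β) (hζ : ζ = α • upSlot₂ + β • ν)
    (hw : w ∈ fccSlots) (hw2 : w 2 = Real.sqrt (2 / 3))
    (hmin : ∀ u ∈ fccSlots, u 2 = Real.sqrt (2 / 3) → ⟪basalMirror w, ζ⟫_ℝ ≤ ⟪basalMirror u, ζ⟫_ℝ) :
    (1 / 4 : ℝ) ≤ -⟪basalMirror w, ν⟫_ℝ := by
  obtain ⟨hu1, hu2, hu3⟩ := upSlots_mem_fccSlots
  have h3 : Real.sqrt 3 ^ 2 = 3 := Real.sq_sqrt (by norm_num)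
  have hunit : ν 0 ^ 2 + ν 1 ^ 2 + ν 2 ^ 2 = 1 := by
    have h := real_inner_self_eq_norm_sq ν
    have h' : ∀ a b : E3, ⟪a, b⟫_ℝ = a 0 * b 0 + a 1 * b 1 + a 2 * b 2 := fun a b => by
      simp [PiLp.inner_apply, Fin.sum_univ_three, mul_comm]
    rw [hνn, one_pow, h'] at h
    linear_combination h
  have hZ : ∀ u : E3, ⟪basalMirror u, ζ⟫_ℝ = α * ⟪basalMirror u, upSlot₂⟫_ℝ + β * ⟪basalMirror u, ν⟫_ℝ := by
    intro u; rw [hζ, inner_add_right, inner_smul_right, inner_smul_right]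
  have hm1 := hmin upSlot₁ hu1 upSlot₁_coord.2.2
  have hm2 := hmin upSlot₂ hu2 upSlot₂_coord.2.2
  have hm3 := hmin upSlot₃ hu3 upSlot₃_coord.2.2
  obtain ⟨n1, n2, n3⟩ := inner_basalMirror_upSlot_fin3 ν
  obtain ⟨g11, g12, g13, g21, g22, g23, g31, g32, g33⟩ := inner_basalMirror_upSlot_upSlot
  rw [(inner_upSlot_fin3 ν).2.1] at hr
  rcases eq_upSlot_of_apply_two hw hw2 with rfl | rfl | rfl
  · -- k = 2, j = 1
    simp only [hZ, g12, g32, g22, n1, n2, n3] at hm1 hm2 hm3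
    rw [n1]
    have hsph : 2 * ((-(1 / 2) * ν 0 + Real.sqrt 3 / 6 * ν 1) ^ 2 + (1 / 2 * ν 0 + Real.sqrt 3 / 6 * ν 1) ^ 2 + (-(Real.sqrt 3 / 3) * ν 1) ^ 2) + ν 2 ^ 2 = 1 := by
      linear_combination hunit + (ν 1 ^ 2 / 3) * h3
    have hP : (-(1 / 2) * ν 0 + Real.sqrt 3 / 6 * ν 1) + (1 / 2 * ν 0 + Real.sqrt 3 / 6 * ν 1) + (-(Real.sqrt 3 / 3) * ν 1) = 0 := by ring
    have hcore := (capperFloor_core (-(1 / 2) * ν 0 + Real.sqrt 3 / 6 * ν 1) (1 / 2 * ν 0 + Real.sqrt 3 / 6 * ν 1) (-(Real.sqrt 3 / 3) * ν 1) (ν 2) α β t hP hsph hν2 ht (by linarith only [hr]) hα hβ).2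
      (by linarith only [hm3])
    linarith only [hcore]
  · -- k = 2, j = 2
    simp only [hZ, g22, g12, g32, n1, n2, n3] at hm1 hm2 hm3
    rw [n2]
    have hsph : 2 * ((-(1 / 2) * ν 0 + Real.sqrt 3 / 6 * ν 1) ^ 2 + (1 / 2 * ν 0 + Real.sqrt 3 / 6 * ν 1) ^ 2 + (-(Real.sqrt 3 / 3) * ν 1) ^ 2) + ν 2 ^ 2 = 1 := by
      linear_combination hunit + (ν 1 ^ 2 / 3) * h3
    have hP : (-(1 / 2) * ν 0 + Real.sqrt 3 / 6 * ν 1) + (1 / 2 * ν 0 + Real.sqrt 3 / 6 * ν 1) + (-(Real.sqrt 3 / 3) * ν 1) = 0 := by ring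
    have hcore := (capperFloor_core (-(1 / 2) * ν 0 + Real.sqrt 3 / 6 * ν 1) (1 / 2 * ν 0 + Real.sqrt 3 / 6 * ν 1) (-(Real.sqrt 3 / 3) * ν 1) (ν 2) α β t hP hsph hν2 ht (by linarith only [hr]) hα hβ).1
      (by linarith only [hm1]) (by linarith only [hm3])
    linarith only [hcore]
  · -- k = 2, j = 3
    simp only [hZ, g32, g12, g22, n1, n2, n3] at hm1 hm2 hm3
    rw [n3]
    have hsph : 2 * ((-(1 / 2) * ν 0 + Real.sqrt 3 / 6 * ν 1) ^ 2 + (-(Real.sqrt 3 / 3) * ν 1) ^ 2 + (1 / 2 * ν 0 + Real.sqrt 3 / 6 * ν 1) ^ 2) + ν 2 ^ 2 = 1 := by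
      linear_combination hunit + (ν 1 ^ 2 / 3) * h3
    have hP : (-(1 / 2) * ν 0 + Real.sqrt 3 / 6 * ν 1) + (-(Real.sqrt 3 / 3) * ν 1) + (1 / 2 * ν 0 + Real.sqrt 3 / 6 * ν 1) = 0 := by ring
    have hcore := (capperFloor_core (-(1 / 2) * ν 0 + Real.sqrt 3 / 6 * ν 1) (-(Real.sqrt 3 / 3) * ν 1) (1 / 2 * ν 0 + Real.sqrt 3 / 6 * ν 1) (ν 2) α β t hP hsph hν2 ht (by linarith only [hr]) hα hβ).2
      (by linarith only [hm1])
    linarith only [hcore]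

/-- Capper floor (model form), launch slot `upSlot₃`: see `capper_floor_model`. -/
theorem capper_floor_model₃ {ν ζ w : E3} {α β t : ℝ} (hνn : ‖ν‖ = 1) (hν2 : 0 ≤ ν 2) (ht : (1 / 4 : ℝ) ≤ t)
    (hr : t ≤ ⟪upSlot₃, ν⟫_ℝ) (hα : 0 ≤ α) (hβ : 0 < β) (hζ : ζ = α • upSlot₃ + β • ν)
    (hw : w ∈ fccSlots) (hw2 : w 2 = Real.sqrt (2 / 3))
    (hmin : ∀ u ∈ fccSlots, u 2 = Real.sqrt (2 / 3) → ⟪basalMirror w, ζ⟫_ℝ ≤ ⟪basalMirror u, ζ⟫_ℝ) :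
    (1 / 4 : ℝ) ≤ -⟪basalMirror w, ν⟫_ℝ := by
  obtain ⟨hu1, hu2, hu3⟩ := upSlots_mem_fccSlots
  have h3 : Real.sqrt 3 ^ 2 = 3 := Real.sq_sqrt (by norm_num)
  have hunit : ν 0 ^ 2 + ν 1 ^ 2 + ν 2 ^ 2 = 1 := by
    have h := real_inner_self_eq_norm_sq ν
    have h' : ∀ a b : E3, ⟪a, b⟫_ℝ = a 0 * b 0 + a 1 * b 1 + a 2 * b 2 := fun a b => by
      simp [PiLp.inner_apply, Fin.sum_univ_three, mul_comm]
    rw [hνn, one_pow, h'] at h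
    linear_combination h
  have hZ : ∀ u : E3, ⟪basalMirror u, ζ⟫_ℝ = α * ⟪basalMirror u, upSlot₃⟫_ℝ + β * ⟪basalMirror u, ν⟫_ℝ := by
    intro u; rw [hζ, inner_add_right, inner_smul_right, inner_smul_right]
  have hm1 := hmin upSlot₁ hu1 upSlot₁_coord.2.2
  have hm2 := hmin upSlot₂ hu2 upSlot₂_coord.2.2
  have hm3 := hmin upSlot₃ hu3 upSlot₃_coord.2.2
  obtain ⟨n1, n2, n3⟩ := inner_basalMirror_upSlot_fin3 ν
  obtain ⟨g11, g12, g13, g21, g22, g23, g31, g32, g33⟩ := inner_basalMirror_upSlot_upSlot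
  rw [(inner_upSlot_fin3 ν).2.2] at hr
  rcases eq_upSlot_of_apply_two hw hw2 with rfl | rfl | rfl
  · -- k = 3, j = 1
    simp only [hZ, g13, g23, g33, n1, n2, n3] at hm1 hm2 hm3
    rw [n1]
    have hsph : 2 * ((-(Real.sqrt 3 / 3) * ν 1) ^ 2 + (1 / 2 * ν 0 + Real.sqrt 3 / 6 * ν 1) ^ 2 + (-(1 / 2) * ν 0 + Real.sqrt 3 / 6 * ν 1) ^ 2) + ν 2 ^ 2 = 1 := by
      linear_combination hunit + (ν 1 ^ 2 / 3) * h3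
    have hP : (-(Real.sqrt 3 / 3) * ν 1) + (1 / 2 * ν 0 + Real.sqrt 3 / 6 * ν 1) + (-(1 / 2) * ν 0 + Real.sqrt 3 / 6 * ν 1) = 0 := by ring
    have hcore := (capperFloor_core (-(Real.sqrt 3 / 3) * ν 1) (1 / 2 * ν 0 + Real.sqrt 3 / 6 * ν 1) (-(1 / 2) * ν 0 + Real.sqrt 3 / 6 * ν 1) (ν 2) α β t hP hsph hν2 ht (by linarith only [hr]) hα hβ).2
      (by linarith only [hm2])
    linarith only [hcore]
  · -- k = 3, j = 2
    simp only [hZ, g23, g13, g33, n1, n2, n3] at hm1 hm2 hm3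
    rw [n2]
    have hsph : 2 * ((-(Real.sqrt 3 / 3) * ν 1) ^ 2 + (-(1 / 2) * ν 0 + Real.sqrt 3 / 6 * ν 1) ^ 2 + (1 / 2 * ν 0 + Real.sqrt 3 / 6 * ν 1) ^ 2) + ν 2 ^ 2 = 1 := by
      linear_combination hunit + (ν 1 ^ 2 / 3) * h3
    have hP : (-(Real.sqrt 3 / 3) * ν 1) + (-(1 / 2) * ν 0 + Real.sqrt 3 / 6 * ν 1) + (1 / 2 * ν 0 + Real.sqrt 3 / 6 * ν 1) = 0 := by ring
    have hcore := (capperFloor_core (-(Real.sqrt 3 / 3) * ν 1) (-(1 / 2) * ν 0 + Real.sqrt 3 / 6 * ν 1) (1 / 2 * ν 0 + Real.sqrt 3 / 6 * ν 1) (ν 2) α β t hP hsph hν2 ht (by linarith only [hr]) hα hβ).2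
      (by linarith only [hm1])
    linarith only [hcore]
  · -- k = 3, j = 3
    simp only [hZ, g33, g13, g23, n1, n2, n3] at hm1 hm2 hm3
    rw [n3]
    have hsph : 2 * ((-(Real.sqrt 3 / 3) * ν 1) ^ 2 + (1 / 2 * ν 0 + Real.sqrt 3 / 6 * ν 1) ^ 2 + (-(1 / 2) * ν 0 + Real.sqrt 3 / 6 * ν 1) ^ 2) + ν 2 ^ 2 = 1 := by
      linear_combination hunit + (ν 1 ^ 2 / 3) * h3
    have hP : (-(Real.sqrt 3 / 3) * ν 1) + (1 / 2 * ν 0 + Real.sqrt 3 / 6 * ν 1) + (-(1 / 2) * ν 0 + Real.sqrt 3 / 6 * ν 1) = 0 := by ring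
    have hcore := (capperFloor_core (-(Real.sqrt 3 / 3) * ν 1) (1 / 2 * ν 0 + Real.sqrt 3 / 6 * ν 1) (-(1 / 2) * ν 0 + Real.sqrt 3 / 6 * ν 1) (ν 2) α β t hP hsph hν2 ht (by linarith only [hr]) hα hβ).1
      (by linarith only [hm1]) (by linarith only [hm2])
    linarith only [hcore]

/-- **Capper floor (model form).**  `v` a reference up-slot with `⟪v, ν⟫ ≥ t ≥ 1/4` for a unit model axis `ν` with `ν₂ ≥ 0`; a steering
`ζ = α v + β ν` (`α ≥ 0 < β`); `w` a reference up-slot that MINIMISES `⟪basalMirror ·, ζ⟫` among the three (so `−w` is a `ζ`-best capper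
of the basal twin): then the capper's rise `⟪basalMirror (−w), ν⟫ = −⟪basalMirror w, ν⟫` is `≥ 1/4` (in fact `≥ min(t, 1/(2√3))`). -/
theorem capper_floor_model {v ν ζ w : E3} {α β t : ℝ} (hv : v ∈ fccSlots) (hv2 : v 2 = Real.sqrt (2 / 3)) (hνn : ‖ν‖ = 1)
    (hν2 : 0 ≤ ν 2) (ht : (1 / 4 : ℝ) ≤ t) (hr : t ≤ ⟪v, ν⟫_ℝ) (hα : 0 ≤ α) (hβ : 0 < β) (hζ : ζ = α • v + β • ν)
    (hw : w ∈ fccSlots) (hw2 : w 2 = Real.sqrt (2 / 3))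
    (hmin : ∀ u ∈ fccSlots, u 2 = Real.sqrt (2 / 3) → ⟪basalMirror w, ζ⟫_ℝ ≤ ⟪basalMirror u, ζ⟫_ℝ) :
    (1 / 4 : ℝ) ≤ -⟪basalMirror w, ν⟫_ℝ := by
  rcases eq_upSlot_of_apply_two hv hv2 with rfl | rfl | rfl
  · exact capper_floor_model₁ hνn hν2 ht hr hα hβ hζ hw hw2 hmin
  · exact capper_floor_model₂ hνn hν2 ht hr hα hβ hζ hw hw2 hmin
  · exact capper_floor_model₃ hνn hν2 ht hr hα hβ hζ hw hw2 hmin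


/-! ## Not steep ⇒ launchable -/

/-- **NOT STEEP ⇒ LAUNCHABLE.**  If some reference up-slot of the up-presentation of `(L, σ)` toward the unit axis `e` rises by
`≥ steerSteepCos c` (`0 ≤ c ≤ 1`, `steerSteepCos c ≥ 1/4` — every chord `c ≤ 1/2`, in particular the chords of record `1/4`, `1/3`),
then the plate admits a launch `(z, v)` of the steered ledgers at chord `c`: `SteerLaunchAt c L σ e z v` — unit `z` within chord `c` of `e`,
`v` steep for `z`, and the `z`-best ∇-capper rising by `≥ 1/4` along `e` (on every bilayer, whatever the word `σ`).  With
`not_steerLaunchAt_of_steepPlateAt` (p706442): the launch-failure set of the two-sided wide-steered ledger is EXACTLY `SteepPlateAt`. -/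
theorem exists_steerLaunchAt_of_not_steepPlateAt {c : ℝ} {L : E3 ≃ₗᵢ[ℝ] E3} {e : E3} (hc0 : 0 ≤ c) (hc1 : c ≤ 1)
    (ht : (1 / 4 : ℝ) ≤ steerSteepCos c) (he : ‖e‖ = 1) (h : ¬ SteepPlateAt c L e) (σ : ℤ → ℤ) :
    ∃ z v : E3, SteerLaunchAt c L σ e z v := by
  simp only [SteepPlateAt, not_forall, not_lt, exists_prop] at h
  obtain ⟨v, hv, hv2, hr⟩ := h
  have hνn : ‖(upFrame L e).symm e‖ = 1 := by rw [LinearIsometryEquiv.norm_map, he]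
  have hν2 : 0 ≤ ((upFrame L e).symm e) 2 := upFrame_axis_nonneg L e
  have hvn : ‖v‖ = 1 := norm_eq_one_of_mem_fccSlots hv
  have hr' : steerSteepCos c ≤ ⟪v, (upFrame L e).symm e⟫_ℝ := by rwa [inner_map_eq_inner_symm] at hr
  obtain ⟨ζ, α, β, hα, hβ, hζ, hζn, hζν, hζv⟩ :=
    exists_model_steering v ((upFrame L e).symm e) c _ hvn hνn rfl hc0 hc1 hr' ((by norm_num : (0:ℝ) ≤ 1 / 4).trans ht)
  refine ⟨upFrame L e ζ, v, ?_, ?_, hv, hv2, ?_, ?_⟩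
  · rw [LinearIsometryEquiv.norm_map, hζn]
  · have : upFrame L e ζ - e = upFrame L e (ζ - (upFrame L e).symm e) := by
      rw [map_sub, LinearIsometryEquiv.apply_symm_apply]
    rw [this, LinearIsometryEquiv.norm_map]; exact hζν
  · rw [LinearIsometryEquiv.inner_map_map]; exact hζv
  · intro i _
    have he3 : (e₃ : E3) = EuclideanSpace.single (2 : Fin 3) (1 : ℝ) := rfl
    -- the ∇-capper `q` and its slot data
    obtain ⟨hqS, hq2⟩ := bestCapper_nabla_slot (upFrame L e) (upFrame L e ζ)
    rw [← he3] at hqS hq2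
    set q := bestCapper (twinFrame (upFrame L e) (upFrame L e e₃)) (upFrame L e e₃) (upFrame L e ζ) with hqdef
    -- maximality of `q` among the positive slots of the twin frame = minimality of `−q` for `⟪basalMirror ·, ζ⟫`
    have hGe : ∀ x : E3, ⟪twinFrame (upFrame L e) (upFrame L e e₃) x, upFrame L e ζ⟫_ℝ = ⟪basalMirror x, ζ⟫_ℝ := by
      intro x; rw [he3, twinFrame_axis_apply, LinearIsometryEquiv.inner_map_map]
    have hrpos : 0 < Real.sqrt (2 / 3) := Real.sqrt_pos.2 (by norm_num)
    have hpos_of_up : ∀ w ∈ fccSlots, w 2 = Real.sqrt (2 / 3) →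
        -w ∈ fccSlots.filter (fun q' => 0 < ⟪twinFrame (upFrame L e) (upFrame L e e₃) q', upFrame L e e₃⟫_ℝ) := by
      intro w hw hw2
      refine Finset.mem_filter.2 ⟨neg_mem_fccSlots hw, ?_⟩
      rw [he3, twinFrame_axis_apply, inner_frame_axis, basalMirror_apply_coord]
      simp only [if_true, PiLp.neg_apply, neg_neg, hw2]; exact hrpos
    have hne : (fccSlots.filter fun q' => 0 < ⟪twinFrame (upFrame L e) (upFrame L e e₃) q', upFrame L e e₃⟫_ℝ).Nonempty :=
      ⟨-upSlot₁, hpos_of_up _ upSlots_mem_fccSlots.1 upSlot₁_coord.2.2⟩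
    obtain ⟨-, hmax⟩ := bestCapper_spec (twinFrame (upFrame L e) (upFrame L e e₃)) (upFrame L e e₃) (upFrame L e ζ) hne
    have hmin : ∀ u ∈ fccSlots, u 2 = Real.sqrt (2 / 3) → ⟪basalMirror (-q), ζ⟫_ℝ ≤ ⟪basalMirror u, ζ⟫_ℝ := by
      intro u hu hu2
      have h1 := hmax (-u) (hpos_of_up u hu hu2)
      rw [hGe, hGe, ← hqdef, map_neg, inner_neg_left] at h1
      rw [map_neg, inner_neg_left]; linarith
    -- the rise of the capper in the model
    rw [inner_map_eq_inner_symm]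
    have hneg : ⟪basalMirror q, (upFrame L e).symm e⟫_ℝ = -⟪basalMirror (-q), (upFrame L e).symm e⟫_ℝ := by
      rw [map_neg, inner_neg_left, neg_neg]
    rw [hneg]
    exact capper_floor_model hv hv2 hνn hν2 ht hr' hα hβ hζ (neg_mem_fccSlots hqS) (by simp [hq2]) hmin

/-- **THE DICHOTOMY**: at chord `c` (`0 ≤ c ≤ 1`, `steerSteepCos c ≥ 1/4`, unit axis `e`) a presented plate admits a launch of the steered
ledgers iff it is not steep — the launch-failure set is `SteepPlateAt c L e` exactly, for every word. -/
theorem exists_steerLaunchAt_iff_not_steepPlateAt {c : ℝ} {L : E3 ≃ₗᵢ[ℝ] E3} {e : E3} (hc0 : 0 ≤ c) (hc1 : c ≤ 1)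
    (ht : (1 / 4 : ℝ) ≤ steerSteepCos c) (he : ‖e‖ = 1) (σ : ℤ → ℤ) :
    (∃ z v : E3, SteerLaunchAt c L σ e z v) ↔ ¬ SteepPlateAt c L e :=
  ⟨fun ⟨z, v, hzv⟩ hs => not_steerLaunchAt_of_steepPlateAt hc0 hc1 he hs σ z v hzv,
    fun h => exists_steerLaunchAt_of_not_steepPlateAt hc0 hc1 ht he h σ⟩

/-- The dichotomy at the chord of record `1/3` toward `e₃` (plate 1) … -/
theorem exists_steerLaunchAt_iff_not_steepPlateAt_third (L : E3 ≃ₗᵢ[ℝ] E3) (σ : ℤ → ℤ) :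
    (∃ z v : E3, SteerLaunchAt (1 / 3) L σ e₃ z v) ↔ ¬ SteepPlateAt (1 / 3) L e₃ :=
  exists_steerLaunchAt_iff_not_steepPlateAt (by norm_num) (by norm_num) steerSteepCos_third_ge_quarter norm_e₃_eq_one σ

/-- … and toward `−e₃` (plate 2). -/
theorem exists_steerLaunchAt_iff_not_steepPlateAt_third_neg (L : E3 ≃ₗᵢ[ℝ] E3) (σ : ℤ → ℤ) :
    (∃ z v : E3, SteerLaunchAt (1 / 3) L σ (-e₃) z v) ↔ ¬ SteepPlateAt (1 / 3) L (-e₃) :=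
  exists_steerLaunchAt_iff_not_steepPlateAt (by norm_num) (by norm_num) steerSteepCos_third_ge_quarter
    (by rw [norm_neg, norm_e₃_eq_one]) σ
end Summit.Ventures.Crystal3D.Cruxes.TextureLiminf.TexShadow

end
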